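import Literature.NumberTheory.LFunctions.Zhang2022.RepairVerdictAssembly
import Literature.NumberTheory.LFunctions.Zhang2022.RepairDiscSFiberCert
import Literature.NumberTheory.LFunctions.Zhang2022.RepairCrossFormSection10H2
import Literature.NumberTheory.LFunctions.Zhang2022.RepairSection10Theta
import Literature.NumberTheory.LFunctions.Zhang2022.RepairTopFormIndefinite
import Literature.NumberTheory.LFunctions.Zhang2022.MainTermFormEll
import Literature.NumberTheory.LFunctions.Zhang2022.Section10Certificate

/-!
# Zhang (2022) design-space objective: the Lean TWIN of the evaluator `OBJ(d)` — objective, `E(d)` schema, CONTROL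

Y. Zhang, *Discrete mean estimates and the Landau–Siegel zero*, arXiv:2211.02515v1 (2022)
[Zhang2022LandauSiegel] — an unrefereed manuscript under adjudication. **This file SEARCHES and TYPES; it
makes no claim about Landau–Siegel zeros, about Theorems 1–2 of the manuscript, or about a repaired
(2.32) (`Skeleton.Margin232`), until a kernel theorem says so.** It is the kernel twin of the LANDAU–SIEGEL
programme's certified evaluator (charter LS-PROGRAMME v1.1 §1–§2, sub-cell A): the objective `OBJ(d)` of a
mollifier / zero-detector DESIGN `d`, written over the kernel objects of the audit tree, with every analytic
input the design needs entering as a NAMED HYPOTHESIS (`Prop`), plus the programme's CONTROL numbers as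
theorems. Companions: `ObjectiveTwinCert` (the rational data-row format and its `decide` checker),
`ObjectiveTwinEllSlope` (the exact ℓ-edge slope `μ₁ = −4π²(π+√(9π²−64))/(π²−8) = −171.55…`).

## A. The objective (charter §1; verdict currency T-true of ruling R3)

The §2 endgame (Props. 2.4–2.6 with (2.18), (2.32)–(2.33), p. 10–11) closes at main order iff
`C₂₃₂·C₂₃₃ < |𝔡′+𝔡|²` (`Section2MainOrder.MainOrderContradiction`, `Section2Assembly.false_of_closing` at
`ε = 0`), `C₂₃₂, C₂₃₃` being the main-term constants of the diagonal means `Ξ₁`, `Ξ_J` and `𝔡′+𝔡` that of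
the cross mean `Ξ₁*`. A design feeds the endgame exactly these three numbers, `MainTerms = (C232, C233,
cross)`; `MainTerms.obj = C232·C233 − |cross|²` is **OBJ(d)** («required minus achieved», squared currency),
`Closes :↔ obj < 0` (`closes_iff_sqrt_lt`: the `MainOrderContradiction` shape), and `objPrint = C232 − 0.001`
is the printed currency of (2.32) (`closes_of_printed_chain`: (2.32) ∧ (2.33) ∧ Prop. 2.4 ⇒ `Closes`).

## B. The `E(d)` schema (charter §1: named estimates)

A design is evaluated through a MAIN-TERM MODEL `FormModel = (Q, P, Adm)` — diagonal functional, polar form,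
admissible profiles. The named estimates identifying its three constants with values of the model are the
fields of `Dictionary F p m` (`diag232 : C232 = Q(𝔤)`, `diag233 : C233 = Q(f)`, `cross : 𝔡′+𝔡 = P(𝔤,f)`,
admissibility of `𝔤`, `f`). In class `R` they are THEOREMS (K-S1…K-S3, `inClass_dictionary`); outside `R⁺`
they are the off-diagonal / error-term estimates a family must NAME (typed elsewhere as `def E_… : Prop`
with status, taken here as hypotheses). Structural theorems: `obj_nonneg_of_cauchySchwarz` (a model with
Cauchy–Schwarz on `Adm` — e.g. `psdModel_cauchySchwarz`, `𝔅` on `H¹` — never closes;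
`inClass_obj_nonneg` = `Repair.not_repairable_true_need` p428635 in this currency) and
`pair_violates_cauchySchwarz_of_closes` (a closing design's model is indefinite on its own pair `(𝔤, f)`:
designs close only where the main-term calculus is indefinite — the knife edges of part D).

## D. CONTROL (charter §2 row A — the in-`R` numbers of record, as kernel facts)

C1 `controlSec18_record : C232S θ₀ ∈ (0.055341, 0.055342)` (`Repair.C232S_theta0_bounds`),
`controlObjPrint_theta0 ∈ (0.05434, 0.05435)`, `controlObj_theta0 : OBJ(θ₀) ∈ (112.86, 112.87)`,
`control_not_objPrint_neg_theta0`; the hull of all documented READINGS of the printed total is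
`ObjectiveTwinCert.controlSec18_readings`. C2 `controlEll_sign` (`F_ℓ(e^{−iπy}) < 0` for `ℓ > 1`,
`mainTermFormEll_neg_of_one_lt` p429407) and `controlEll_rayleighSlope` (`d/dℓ F_ℓ(e^{−iπy})|₁ = −16π`); the
exact minimal slope `−171.55` is `ObjectiveTwinEllSlope.ellSlopeMin_bounds`. C3 `controlTop_psd` /
`controlTop_indefinite` (`Repair.topDiagForm_re_nonneg_of_le_one`, `Repair.topForm_indefinite` p430338).

Pure definitions, linear arithmetic and re-exports; no analytic content, no new `Prop` facts about the
manuscript.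
-/

noncomputable section

open Real Complex ComplexConjugate MeasureTheory Set

namespace Literature.NumberTheory.LFunctions.Zhang2022

namespace Objective

open Repair

/-! ## A. The three endgame constants of a design and the objective -/

/-- The main-order data a design `d` feeds into the §2 endgame: the constants of the three discrete means
`Ξ₁ ~ C₂₃₂·𝔞𝔓` ((2.32)/(8.1)), `Ξ_J ~ C₂₃₃·𝔞𝔓` ((2.33)) and `Ξ₁* ~ (𝔡′+𝔡)·𝔞𝔓` ((2.17)/(10.17)).
[cite: Zhang2022LandauSiegel, §2 (2.17)–(2.18), (2.32)–(2.33); §10 (10.17)] -/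
structure MainTerms where
  /-- `C₂₃₂`: main-term constant of `Ξ₁ = Σ𝔠*|H₁ + ZH̄₂|²ω` -/
  C232 : ℝ
  /-- `C₂₃₃`: main-term constant of `Ξ_J = Σ𝔠*|J₁|²ω` -/
  C233 : ℝ
  /-- `𝔡′ + 𝔡`: main-term constant of `Ξ₁*` -/
  cross : ℂ

namespace MainTerms

/-- **OBJ(d)** in the T-true currency (ruling R3): `C₂₃₂·C₂₃₃ − |𝔡′+𝔡|²` — what `|𝔡′+𝔡|²` is required to
exceed, minus what it achieves. [cite: Zhang2022LandauSiegel, §2 (2.18), Props. 2.4–2.6] -/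
def obj (m : MainTerms) : ℝ := m.C232 * m.C233 - ‖m.cross‖ ^ 2

/-- OBJ(d) in the PRINTED currency of (2.32): `C₂₃₂ − 0.001` (the manuscript needs `C₂₃₂ < 0.001`;
tree node `Skeleton.Margin232` at the printed design). [cite: Zhang2022LandauSiegel, §18 p.99, §2 (2.32)] -/
def objPrint (m : MainTerms) : ℝ := m.C232 - 1 / 1000

/-- A design CLOSES the §2 endgame at main order iff `OBJ(d) < 0`, i.e. `C₂₃₂·C₂₃₃ < |𝔡′+𝔡|²`.
[cite: Zhang2022LandauSiegel, §2 (2.18), Props. 2.4–2.6] -/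
def Closes (m : MainTerms) : Prop := m.obj < 0

/-- `Closes ↔ C₂₃₂·C₂₃₃ < |𝔡′+𝔡|²`. [cite: Zhang2022LandauSiegel, §2 (2.18)] -/
theorem closes_iff (m : MainTerms) : m.Closes ↔ m.C232 * m.C233 < ‖m.cross‖ ^ 2 := by
  unfold Closes obj; constructor <;> intro h <;> linarith

/-- `Closes ↔ √(C₂₃₂·C₂₃₃) < |𝔡′+𝔡|` when `C₂₃₂·C₂₃₃ ≥ 0` — the shape of
`Section2MainOrder.MainOrderContradiction` / `Section2Assembly.false_of_closing` (at `ε = 0`).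
[cite: Zhang2022LandauSiegel, §2 (2.18), Props. 2.4–2.6] -/
theorem closes_iff_sqrt_lt (m : MainTerms) (h0 : 0 ≤ m.C232 * m.C233) :
    m.Closes ↔ Real.sqrt (m.C232 * m.C233) < ‖m.cross‖ := by
  rw [closes_iff]
  constructor
  · intro h
    have h1 := Real.sqrt_lt_sqrt h0 h
    rwa [Real.sqrt_sq (norm_nonneg _)] at h1
  · intro h
    have h1 : Real.sqrt (m.C232 * m.C233) ^ 2 < ‖m.cross‖ ^ 2 :=
      pow_lt_pow_left₀ h (Real.sqrt_nonneg _) two_ne_zero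
    rwa [Real.sq_sqrt h0] at h1

/-- `√(C₂₃₂·C₂₃₃) < |𝔡′+𝔡|` always implies `Closes` (no sign hypothesis).
[cite: Zhang2022LandauSiegel, §2 (2.18), Props. 2.4–2.6] -/
theorem closes_of_sqrt_lt (m : MainTerms) (h : Real.sqrt (m.C232 * m.C233) < ‖m.cross‖) : m.Closes := by
  by_cases h0 : 0 ≤ m.C232 * m.C233
  · exact (m.closes_iff_sqrt_lt h0).2 h
  · rw [closes_iff]; nlinarith [norm_nonneg m.cross, not_le.1 h0]

/-- The PRINTED chain implies the T-true closing: (2.32) `C₂₃₂ < 0.001`, (2.33) `C₂₃₃ < 3000` and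
Proposition 2.4 `|𝔡′+𝔡|² > 25` (with `C₂₃₂ ≥ 0`, as for any value of a mean square) give `Closes`, since
`0.001·3000 = 3 < 25`. [cite: Zhang2022LandauSiegel, §2 Props. 2.4–2.5, (2.32)–(2.33)] -/
theorem closes_of_printed_chain (m : MainTerms) (h0 : 0 ≤ m.C232) (h32 : m.C232 < 1 / 1000)
    (h33 : m.C233 < 3000) (h24 : 25 < ‖m.cross‖ ^ 2) : m.Closes := by
  rw [closes_iff]
  by_cases h33' : 0 ≤ m.C233
  · nlinarith [mul_le_mul h32.le h33.le h33' (by norm_num : (0:ℝ) ≤ 1 / 1000)]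
  · nlinarith [mul_nonpos_iff.2 (Or.inl ⟨h0, (not_le.1 h33').le⟩), norm_nonneg m.cross]

/-- `objPrint < 0 ↔ C₂₃₂ < 0.001` (the printed (2.32) target). [cite: Zhang2022LandauSiegel, §2 (2.32), §18 p.99] -/
theorem objPrint_neg_iff (m : MainTerms) : m.objPrint < 0 ↔ m.C232 < 1 / 1000 := by
  unfold objPrint; constructor <;> intro h <;> linarith

end MainTerms

/-! ## B. Main-term models, the dictionary `E(d)`, and the two structural theorems -/

/-- A MAIN-TERM MODEL for a design family: a diagonal functional `Q(g, g′) ∈ ℝ` on profiles with marked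
derivative, its polar form `P(g, g′, f, f′) ∈ ℂ`, and the class `Adm` of profiles on which the family claims
the model. Instances: the manuscript's `𝔅 = mainTermForm` with `H¹[0,1]` profiles (`psdModel`, class `R`);
the continued forms `F_ℓ = mainTermFormEll ℓ` (ℓ-edge) and `𝔅_T = Repair.topDiagForm T` (length edge) of
the knife-edge files; any `𝔅 + 𝔒` a §B family names. [cite: Zhang2022LandauSiegel, §2 (2.18), (2.32)–(2.33); §7 Prop. 7.1] -/
structure FormModel where
  /-- the diagonal main-term functional `Q(g) = Q(g, g′)` -/
  Q : (ℝ → ℂ) → (ℝ → ℂ) → ℝ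
  /-- its polar form `P(g, f)` -/
  P : (ℝ → ℂ) → (ℝ → ℂ) → (ℝ → ℂ) → (ℝ → ℂ) → ℂ
  /-- the admissible profiles of the model -/
  Adm : (ℝ → ℂ) → (ℝ → ℂ) → Prop

/-- The two profiles of a design: the glued `H`-side profile `𝔤` (mollifier / detector of `Ξ₁`) and the
`J`-side probe `f` (of `Ξ_J`), each with its marked derivative. [cite: Zhang2022LandauSiegel, §2 (2.23)–(2.30)] -/
structure DesignProfiles where
  /-- `𝔤` -/
  g : ℝ → ℂ
  /-- `𝔤′` -/
  g' : ℝ → ℂ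
  /-- `f` -/
  f : ℝ → ℂ
  /-- `f′` -/
  f' : ℝ → ℂ

/-- **The dictionary of a design = its named estimates `E(d)`**: the design's profiles are admissible for the
model, and its three endgame constants ARE the model's values — `C₂₃₂ = Q(𝔤)` (diagonal `H`-side mean,
K-S1 + K-S2 in class `R`), `C₂₃₃ = Q(f)` (K-S1), `𝔡′+𝔡 = P(𝔤, f)` (K-S3). Outside class `R⁺` each field is an
off-diagonal / error-term ESTIMATE the design family must supply by name. [cite: Zhang2022LandauSiegel, §2 (2.18), (2.32)–(2.33); §8 (8.23); §9 (9.7); §10 (10.17); §18 (18.1)] -/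
structure Dictionary (F : FormModel) (p : DesignProfiles) (m : MainTerms) : Prop where
  /-- `𝔤` is admissible for the model -/
  adm_g : F.Adm p.g p.g'
  /-- `f` is admissible for the model -/
  adm_f : F.Adm p.f p.f'
  /-- `E_diag(𝔤)`: `C₂₃₂ = Q(𝔤)` -/
  diag232 : m.C232 = F.Q p.g p.g'
  /-- `E_diag(f)`: `C₂₃₃ = Q(f)` -/
  diag233 : m.C233 = F.Q p.f p.f'
  /-- `E_cross`: `𝔡′+𝔡 = P(𝔤, f)` -/
  cross : m.cross = F.P p.g p.g' p.f p.f'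

/-- The Cauchy–Schwarz property of a model on its admissible class: `|P(g,f)|² ≤ Q(g)·Q(f)` (holds for every
positive semidefinite Hermitian form); the step «by Cauchy's inequality» of the §2 endgame.
[cite: Zhang2022LandauSiegel, §2 (2.18), Props. 2.4–2.6] -/
def FormModel.CauchySchwarz (F : FormModel) : Prop :=
  ∀ g g' f f', F.Adm g g' → F.Adm f f' → ‖F.P g g' f f'‖ ^ 2 ≤ F.Q g g' * F.Q f f'

variable {F : FormModel} {p : DesignProfiles} {m : MainTerms}

/-- With a dictionary, `OBJ(d) = Q(𝔤)·Q(f) − |P(𝔤,f)|²`. [cite: Zhang2022LandauSiegel, §2 (2.18), (2.32)–(2.33)] -/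
theorem obj_eq_of_dictionary (hD : Dictionary F p m) :
    m.obj = F.Q p.g p.g' * F.Q p.f p.f' - ‖F.P p.g p.g' p.f p.f'‖ ^ 2 := by
  rw [MainTerms.obj, hD.diag232, hD.diag233, hD.cross]

/-- **Barrier side (structural): a Cauchy–Schwarz model never closes.** If the design's model satisfies
Cauchy–Schwarz on its admissible class and the dictionary `E(d)` holds, then `OBJ(d) ≥ 0`.
[cite: Zhang2022LandauSiegel, §2 (2.18), Props. 2.4–2.6, (2.32)–(2.33)] -/
theorem obj_nonneg_of_cauchySchwarz (hF : F.CauchySchwarz) (hD : Dictionary F p m) : 0 ≤ m.obj := by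
  rw [obj_eq_of_dictionary hD]
  linarith [hF _ _ _ _ hD.adm_g hD.adm_f]

/-- … hence such a design does not close. [cite: Zhang2022LandauSiegel, §2 (2.18), Props. 2.4–2.6] -/
theorem not_closes_of_cauchySchwarz (hF : F.CauchySchwarz) (hD : Dictionary F p m) : ¬ m.Closes :=
  not_lt.2 (obj_nonneg_of_cauchySchwarz hF hD)

/-- **Door side (structural): a closing design's model violates Cauchy–Schwarz on its own pair `(𝔤, f)`** —
`Q(𝔤)·Q(f) < |P(𝔤,f)|²`; in particular the model is not positive semidefinite on `span{𝔤, f}`. Designs can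
close only where the main-term calculus is indefinite (the knife edges). [cite: Zhang2022LandauSiegel, §2 (2.18), Props. 2.4–2.6] -/
theorem pair_violates_cauchySchwarz_of_closes (hD : Dictionary F p m) (h : m.Closes) :
    F.Q p.g p.g' * F.Q p.f p.f' < ‖F.P p.g p.g' p.f p.f'‖ ^ 2 := by
  have h' := (MainTerms.closes_iff m).1 h
  rwa [hD.diag232, hD.diag233, hD.cross] at h'

/-- … so a closing design with a dictionary refutes the Cauchy–Schwarz property of its model.
[cite: Zhang2022LandauSiegel, §2 (2.18), Props. 2.4–2.6] -/
theorem not_cauchySchwarz_of_closes (hD : Dictionary F p m) (h : m.Closes) : ¬ F.CauchySchwarz :=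
  fun hF => not_closes_of_cauchySchwarz hF hD h

/-! ## C. The in-class instance: model `𝔅` on `H¹`, class `R` -/

/-- The manuscript's own model: the glued main-term form `𝔅 = mainTermForm` (STRUCTURE (4.1),
`MainTermFormPSD`), its polar form `mainTermFormPolar`, on `H¹[0,1]` profiles. [cite: Zhang2022LandauSiegel, §7 Prop. 7.1; §8 (8.19)–(8.23)] -/
def psdModel : FormModel where
  Q := mainTermForm
  P := mainTermFormPolar
  Adm := IsH1OnUnitInterval

/-- `𝔅` is Cauchy–Schwarz on `H¹` (`MainTermFormCauchySchwarz.norm_sq_mainTermFormPolar_le`, from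
`mainTermForm_nonneg_of_isH1`). [cite: Zhang2022LandauSiegel, §2 (2.18), Props. 2.4–2.6] -/
theorem psdModel_cauchySchwarz : psdModel.CauchySchwarz :=
  fun _ _ _ _ hg hf => norm_sq_mainTermFormPolar_le hg hf

/-- The endgame constants OF RECORD of a class-`R` design `θ`: `C232S θ` (exact bilinear `𝔠₃`, ruling R2),
`C233T θ`, `dSumS θ`. [cite: Zhang2022LandauSiegel, §18 (18.1), (2.32); §10 (10.17), (10.19); (2.33)] -/
def inClassTerms (θ : Theta) : MainTerms := ⟨C232S θ, C233T θ, dSumS θ⟩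

/-- The profiles of a class-`R` design: glued `H`-profile `𝔤_θ = g₁ + R̃g₂` and tent `f_θ`.
[cite: Zhang2022LandauSiegel, §2 (2.23)–(2.28)] -/
def inClassProfiles (θ : Theta) : DesignProfiles := ⟨gluedS θ, gluedS' θ, tentT θ, tentT' θ⟩

/-- `(inClassTerms θ).C232 = C232S θ`. [cite: Zhang2022LandauSiegel, §18 (18.1), (2.32)] -/
@[simp] theorem inClassTerms_C232 (θ : Theta) : (inClassTerms θ).C232 = C232S θ := rfl
/-- `(inClassTerms θ).C233 = C233T θ`. [cite: Zhang2022LandauSiegel, (2.33), §10 (10.19)] -/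
@[simp] theorem inClassTerms_C233 (θ : Theta) : (inClassTerms θ).C233 = C233T θ := rfl
/-- `(inClassTerms θ).cross = dSumS θ`. [cite: Zhang2022LandauSiegel, §10 (10.17)] -/
@[simp] theorem inClassTerms_cross (θ : Theta) : (inClassTerms θ).cross = dSumS θ := rfl

/-- **In class `R` the dictionary is a THEOREM** (K-S1…K-S3: `Repair.glued_isH1_on_class`,
`tent_isH1_on_class`, `h232_on_class`, `h233_on_class`, `hsum_on_class`). [cite: Zhang2022LandauSiegel, §8 (8.23); §9 (9.7); §10 (10.17); §18 (18.1)] -/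
theorem inClass_dictionary {θ : Theta} (h : AdmissibleTheta θ) :
    Dictionary psdModel (inClassProfiles θ) (inClassTerms θ) where
  adm_g := glued_isH1_on_class θ h
  adm_f := tent_isH1_on_class θ h
  diag232 := h232_on_class θ h
  diag233 := h233_on_class θ h
  cross := hsum_on_class θ h

/-- **`OBJ ≥ 0` on class `R`** — `Repair.not_repairable_true_need` (p428635) in the objective's currency.
[cite: Zhang2022LandauSiegel, §2 Props. 2.4–2.6, (2.32)–(2.33)] -/
theorem inClass_obj_nonneg {θ : Theta} (h : AdmissibleTheta θ) : 0 ≤ (inClassTerms θ).obj :=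
  obj_nonneg_of_cauchySchwarz psdModel_cauchySchwarz (inClass_dictionary h)

/-- No class-`R` design closes. [cite: Zhang2022LandauSiegel, §2 Props. 2.4–2.6, (2.32)–(2.33)] -/
theorem inClass_not_closes {θ : Theta} (h : AdmissibleTheta θ) : ¬ (inClassTerms θ).Closes :=
  not_closes_of_cauchySchwarz psdModel_cauchySchwarz (inClass_dictionary h)

/-! ## D. CONTROL — the three in-class numbers of record as kernel facts -/

/-- **C1 (functional of record)**: `C₂₃₂ˢ(θ₀) ∈ (0.055341, 0.055342)` — the §18 total with the exact
bilinear `𝔠₃` at the printed design (`Repair.C232S_theta0_bounds`; true value `0.05534154`).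
[cite: Zhang2022LandauSiegel, §18 p.99, (2.32)] -/
theorem controlSec18_record :
    (0.055341 : ℝ) < (inClassTerms theta0).C232 ∧ (inClassTerms theta0).C232 < 0.055342 :=
  C232S_theta0_bounds

/-- **C1 (printed currency)**: `OBJ_print(θ₀) ∈ (0.05434, 0.05435)` — the printed target `0.001` is missed
by `0.0543`. [cite: Zhang2022LandauSiegel, §18 p.99, (2.32)] -/
theorem controlObjPrint_theta0 :
    (0.05434 : ℝ) < (inClassTerms theta0).objPrint ∧ (inClassTerms theta0).objPrint < 0.05435 := by
  have h := C232S_theta0_bounds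
  unfold MainTerms.objPrint
  simp only [inClassTerms_C232]
  constructor <;> linarith [h.1, h.2]

/-- **C1 (T-true currency)**: `OBJ(θ₀) = C₂₃₂ˢ(θ₀)·C₂₃₃ − |𝔡′+𝔡|² ∈ (112.86, 112.87)` (from
`C232S_theta0_bounds`, `C233T_theta0`/`C233_bounds`, `dSumS_theta0`/`dsum_normSq_bounds`: `0.0553415 × 2546.85
− 28.0792`). [cite: Zhang2022LandauSiegel, §2 (2.18), (2.32)–(2.33); §10 (10.17)] -/
theorem controlObj_theta0 :
    (112.86 : ℝ) < (inClassTerms theta0).obj ∧ (inClassTerms theta0).obj < 112.87 := by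
  have h1 := C232S_theta0_bounds
  have h2 := C233_bounds
  have h3 := dsum_normSq_bounds
  unfold MainTerms.obj
  simp only [inClassTerms_C232, inClassTerms_C233, inClassTerms_cross, C233T_theta0, dSumS_theta0,
    ← Complex.normSq_eq_norm_sq]
  constructor <;> nlinarith [h1.1, h1.2, h2.1, h2.2, h3.1, h3.2]

/-- **C1 (the node, printed currency at `θ₀`)**: `OBJ_print(θ₀) > 0`, i.e. the functional of record misses the
printed (2.32) target (the node itself, `¬ Skeleton.Margin232`, is `Skeleton.not_margin232` p403315 /
`Repair.not_margin232_iota`, not restated here). [cite: Zhang2022LandauSiegel, §18 p.99, (2.32)] -/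
theorem control_not_objPrint_neg_theta0 : ¬ (inClassTerms theta0).objPrint < 0 :=
  not_lt.2 (le_of_lt (lt_trans (by norm_num) controlObjPrint_theta0.1))

/-- **C3 (PSD side)**: up to length `P` the continued one-sided diagonal form is `≥ 0` on every kinked
profile vanishing beyond its top (`Repair.topDiagForm_re_nonneg_of_le_one`). [cite: Zhang2022LandauSiegel, §7 Prop. 7.1, (7.2)] -/
theorem controlTop_psd {T : ℝ} {g g' : ℝ → ℂ} (hT0 : 0 < T) (hT : T ≤ 1) (hg : KinkedProfile g g')
    (hg0 : ∀ y, T ≤ y → g y = 0) (hg'0 : ∀ y, T ≤ y → g' y = 0) : 0 ≤ (topDiagForm T g g').re :=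
  topDiagForm_re_nonneg_of_le_one hT0 hT hg hg0 hg'0

/-- **C3 (indefinite side, the witness)**: for every length exponent `θ > 1` there is a one-sided profile
with `Re 𝔅_θ(g) = −1` (`Repair.topForm_indefinite`, p430338). [cite: Zhang2022LandauSiegel, §7 Prop. 7.1, (7.2)] -/
theorem controlTop_indefinite {θ : ℝ} (hθ : 1 < θ) :
    ∃ g g' : ℝ → ℂ, OneSidedProfile θ g g' ∧ (topDiagForm θ g g').re = -1 :=
  topForm_indefinite hθ

/-- **C2 (sign)**: for every `ℓ > 1` the deformed main-term form is negative on the first AFE direction,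
`F_ℓ(e^{−iπy}) = −8π(ℓ−1)(2ℓ−1)(3ℓ−1) < 0` (`mainTermFormEll_neg_of_one_lt`, p429407).
[cite: Zhang2022LandauSiegel, §2 (2.10), (2.13)] -/
theorem controlEll_sign {ℓ : ℝ} (hℓ : 1 < ℓ) : mainTermFormEll ℓ (afeDir 1) (afeDir' 1) < 0 :=
  mainTermFormEll_neg_of_one_lt hℓ

/-- **C2 (Rayleigh slope on the first AFE direction)**: `d/dℓ F_ℓ(e^{−iπy})|_{ℓ=1} = −16π` (`= μ₂` of the
record repair/num-1 L11 §3; `‖e^{−iπy}‖_{L²} = 1`). [cite: Zhang2022LandauSiegel, §2 (2.10), (2.13)] -/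
theorem controlEll_rayleighSlope :
    HasDerivAt (fun ℓ : ℝ => mainTermFormEll ℓ (afeDir 1) (afeDir' 1)) (-(16 * π)) 1 := by
  have h1 : HasDerivAt (fun ℓ : ℝ => ℓ - 1) 1 1 := (hasDerivAt_id (1:ℝ)).sub_const 1
  have h2 : HasDerivAt (fun ℓ : ℝ => 2 * ℓ - 1) 2 1 := by
    simpa using ((hasDerivAt_id (1:ℝ)).const_mul 2).sub_const 1
  have h3 : HasDerivAt (fun ℓ : ℝ => 3 * ℓ - 1) 3 1 := by
    simpa using ((hasDerivAt_id (1:ℝ)).const_mul 3).sub_const 1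
  have h := (((h1.mul h2).mul h3).const_mul (8 * π)).neg
  refine (h.congr_deriv ?_).congr_of_eventuallyEq (Filter.Eventually.of_forall fun ℓ => ?_)
  · simp only [Pi.mul_apply]
    ring
  · simp only [Pi.neg_apply, Pi.mul_apply, mainTermFormEll_afeDir_one]

end Objective

end Literature.NumberTheory.LFunctions.Zhang2022
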